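import Literature.NumberTheory.Automorphic.KimExteriorSquareGL4Descent
import HarnessLib

/-!
# Kim's exterior square lift `∧² : GL₄ → GL₆` (Theorem 4.2.3): the four printed leaves named, and the assembly

Topic `Literature/NumberTheory/Automorphic`. Fact-decomposition record (librarian, fact-decompose,
2026-08-16) for the named fact `Literature.NumberTheory.Automorphic.Kim2003_exteriorSquare_GL4`
(H. H. Kim, J. Amer. Math. Soc. **16** (2003), Thm. A p. 139 = Thm. 4.2.3 p. 156, weak/Satake
form), an XL fact that ran to the prover budget cap. Its proof files (`KimExteriorSquareGL4Proofs`,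
`…Descent`, `…Reduction`, `…Twist`, `…Archimedean*`) formalise the ARCHITECTURE of Kim's proof of
Theorem 4.2.3 (§4.2, pp. 156–158: induction on `r(π)` over all number fields reducing the general
case to the good case by cyclic base change and Ramakrishnan's descent) and PROVE the fact from
four CLOSED hypotheses (`Kim2003_exteriorSquare_GL4.of_leaves'`), each a published result with no
carrier-level proof in the tree, "each a statement a planner can vendor verbatim as a named fact"
(module docstring of `…Descent`). They are named here, symbol for symbol:

* `Kim2003_exteriorSquare_goodCase` — **Thm. 4.1.1 with its proof** (pp. 153–154): for GOOD `π`
  ("Following [Ra1], we say `π` is good if none of `π_v` is supercuspidal", p. 153) and every finite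
  non-empty set `S` of finite places outside which `π` is unramified, some automorphic `P` on
  `GL₆(𝔸_K)` has `t_{P,v} = ∧² t_{π,v}` at every `v ∉ S` (converse theorem of Cogdell–Piatetski-Shapiro,
  Thm. 2.1, applied to `∧²π` and `S`; analytic input §3, Langlands–Shahidi on `Spin(2n)`).
* `Kim2003_exteriorSquare_inductionStepFamily` — **the family of the induction step** (pp. 156–157:
  Henniart's Thm. 4.2.1, Grunwald–Wang, class field theory, Chebotarev, Lemma 4.2.2 [Ra1, 3.6.2],
  Arthur–Clozel Ch. 3 Thm. 4.2 (a) / 5.1), with Kim's rank `r(π) = (l(π), p(π))` quantified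
  existentially (any well-founded order): for `π` NOT good and any sequence of unramified places
  `v_j`, a prime `p` and, for all `j` outside a finite set, pairwise non-isomorphic Galois
  extensions `K_j/K` of degree `p` in which `v_j` splits, with cuspidal base changes `π_{K_j}` of
  smaller rank.
* `Kim2003_descentCriterion_isobaric` — **Prop. 4.2.4–4.2.5** (Ramakrishnan's descent criterion
  [Ra1, §3.6] for cuspidal families, and its isobaric extension, Appendix 1, with Remark 4.2), on
  Satake parameters, for `GL_n` and any prime degree `p`.
* `Langlands1979_cuspidalSupport_satakeParams` — **cuspidal support** (Kim (4.1), p. 154, after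
  [J-S3]; R. P. Langlands, *On the notion of an automorphic representation* (1979), Prop. 2): every
  automorphic representation of `GL_n(𝔸_F)` has cuspidal data `σᵢ` on `GL_{nᵢ}`, `∑ nᵢ = n`, with
  `t_{P,v} = ⊎ᵢ t_{σᵢ,v}` for almost all `v` — the isobaric clause (ii) of the fact read backwards.

The assembly `Kim2003_exteriorSquare_GL4_holds_of` is `Kim2003_exteriorSquare_GL4.of_leaves'`.
Carriers: `CuspidalAutomorphicRepData`, `AutomorphicRepData (AutomorphyDatum.gl n F _)`,
`HasSatakeParamAt`, `IsUnramifiedAt` (`AutomorphicRepsGL`), local components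
`AutomorphicRepData.HasLocalComponentAt` and `Representation.IsSupercuspidal` (`LocalComponentBJ`,
`MatrixCoefficients`); `hF m` is the standing fact `isCompact_glFiniteIntegralLevel m F`.

## References

* [Kim2002] H. H. Kim, *Functoriality for the exterior square of GL₄ and the symmetric fourth of
  GL₂*, J. Amer. Math. Soc. 16 (2003) 139–183: Thm. 2.1 (p. 143), §4.1 Thm. 4.1.1 (pp. 153–154),
  (4.1) (p. 154), Thm. 4.2.1, Lemma 4.2.2, Thm. 4.2.3, Prop. 4.2.4–4.2.5, Remark 4.2 (pp. 156–158),
  Appendix 1.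
* [Ramakrishnan2000] D. Ramakrishnan, *Modularity of the Rankin–Selberg L-series, and multiplicity
  one for SL(2)*, Ann. of Math. 152 (2000), §3.6 (Prop. 3.6.1), Lemma 3.6.2.
* [ArthurClozelAMS120] J. Arthur, L. Clozel, *Simple algebras, base change, and the advanced theory
  of the trace formula* (1989), Ch. 3, (1.1), Thm. 4.2 (a), Thm. 5.1.
* [LanglandsCorvallis1979Notion] R. P. Langlands, *On the notion of an automorphic representation*,
  Proc. Sympos. Pure Math. 33 (1979), Part 1, Prop. 2.
-/

noncomputable section

open scoped Classical MatrixGroups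
open IsDedekindDomain NumberField Filter

namespace Literature.NumberTheory.Automorphic

/-! ### The four leaves, named -/

/-- **Kim 2003, Thm. 4.1.1 with its proof (pp. 153–154): the exterior square lift in the GOOD case,
with its exceptional set.** For a cuspidal `π` on `GL₄(𝔸_K)` which is good — none of its local
components at finite places is supercuspidal (p. 153: "Following [Ra1], we say `π` is good if none
of `π_v` is supercuspidal"; rendered through the tree's local components of a Borel–Jacquet datum,
`AutomorphicRepData.HasLocalComponentAt`, and `Representation.IsSupercuspidal`) — and every finite
non-empty set `S` of finite places outside which `π` is unramified, there is an automorphic `P` on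
`GL₆(𝔸_K)` with `t_{P,v} = ∧² t_{π,v}` (`wedgeTwoParams`) at EVERY `v ∉ S` (pp. 153–154: "we can
apply the converse theorem (Theorem 2.1) to `∧²π` and `S`, where `S` is a finite set of finite places
such that `π_v` is unramified for `v ∉ S` … there exists an automorphic representation `Π = ⊗ Π_v`
of `GL₆(𝔸)` such that `Π_v ≃ ∧²π_v` for all `v ∉ S`"; `S ≠ ∅` because the proof twists by a
character highly ramified at a place of `S`). Verbatim the hypothesis `hGood` of
`Kim2003_exteriorSquare_GL4.of_leaves'` (`KimExteriorSquareGL4Descent`).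
[cite: Kim2002, Thm. 4.1.1 and its proof (pp. 153–154), with Thm. 2.1 (p. 143) and §3] -/
def Kim2003_exteriorSquare_goodCase : Prop :=
  ∀ (K : Type) [Field K] [NumberField K]
    (hK : ∀ m : ℕ, isCompact_glFiniteIntegralLevel m K) (π : CuspidalAutomorphicRepData 4 K (hK 4)),
    (∀ (v : HeightOneSpectrum (𝓞 K)) (πv : SmoothIrrep (GL (Fin 4) (v.adicCompletion K))),
        π.1.HasLocalComponentAt v πv.ρ → ¬ πv.ρ.IsSupercuspidal) →
    ∀ S : Set (HeightOneSpectrum (𝓞 K)), S.Finite → S.Nonempty →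
      (∀ v ∉ S, π.1.IsUnramifiedAt v) →
      ∃ P : AutomorphicRepData (AutomorphyDatum.gl 6 K (hK 6)),
        ∀ v ∉ S, ∀ α : Multiset ℂ,
          π.1.HasSatakeParamAt v α → P.HasSatakeParamAt v (wedgeTwoParams α)

/-- **Kim 2003, pp. 156–157: the family of the induction step in the proof of Thm. 4.2.3.** For a
cuspidal `π` on `GL₄(𝔸_K)` which is NOT good and any sequence `(v_j)` of finite places at which `π`
is unramified, there are a prime `p` and, for all `j` outside a finite set of indices ("by throwing
away finitely many indices"), pairwise non-isomorphic Galois extensions `K_j/K` of degree `p` in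
which `v_j` splits (a place `w_j ∣ v_j` with `e = f = 1`), with CUSPIDAL base changes `π_{K_j}`
(`t_{π_{K_j},w} = t_{π,v}^{f(w|v)}` at every `w ∣ v` with `π` unramified at `v` — Arthur–Clozel's
lift is strong, Ch. 3 Thm. 5.1) of strictly smaller rank, `r(π_{K_j}) < r(π)` ("So by construction,
for every `j ≥ 1`, `r(π_{K_j}) < r`", p. 157). Inputs in print: Henniart's Thm. 4.2.1 [He1], the
Grunwald–Wang theorem [A-T, Ch. 10, Thm. 5], class field theory, Chebotarev, Lemma 4.2.2
[Ra1, Lemma 3.6.2] with [Ra1, Prop. 2.3.1], and base change [Arthur–Clozel, Ch. 3, Thm. 4.2 (a),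
Thm. 5.1]. Kim's rank `r(π) = (l(π), p(π))` (p. 156, built from Henniart's lengths of the
supercuspidal components) is quantified existentially: some rank function into a well-founded order
works. Verbatim the hypothesis `hStep` of `Kim2003_exteriorSquare_GL4.of_leaves'`.
[cite: Kim2002, proof of Thm. 4.2.3 (pp. 156–157), Thm. 4.2.1, Lemma 4.2.2] [cite: ArthurClozelAMS120, Ch. 3 Thm. 4.2 (a) and Thm. 5.1] -/
def Kim2003_exteriorSquare_inductionStepFamily : Prop :=
  ∃ (ρ₀ : Type) (_ : LT ρ₀) (_ : WellFoundedLT ρ₀)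
      (rk : ∀ (K : Type) [Field K] [NumberField K]
        (hK : ∀ m : ℕ, isCompact_glFiniteIntegralLevel m K), CuspidalAutomorphicRepData 4 K (hK 4) → ρ₀),
    ∀ (K : Type) [Field K] [NumberField K]
      (hK : ∀ m : ℕ, isCompact_glFiniteIntegralLevel m K) (π : CuspidalAutomorphicRepData 4 K (hK 4)),
      ¬ (∀ (v : HeightOneSpectrum (𝓞 K)) (πv : SmoothIrrep (GL (Fin 4) (v.adicCompletion K))),
          π.1.HasLocalComponentAt v πv.ρ → ¬ πv.ρ.IsSupercuspidal) →
      ∀ v : ℕ → HeightOneSpectrum (𝓞 K), (∀ j, π.1.IsUnramifiedAt (v j)) →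
      ∃ (p : ℕ) (J : Set ℕ) (E : J → Type) (_ : ∀ j, Field (E j)) (_ : ∀ j, NumberField (E j))
        (_ : ∀ j, Algebra K (E j)) (hE : ∀ (j : J) (m : ℕ), isCompact_glFiniteIntegralLevel m (E j))
        (πE : ∀ j : J, CuspidalAutomorphicRepData 4 (E j) (hE j 4)),
        p.Prime ∧ Jᶜ.Finite ∧ (∀ j, IsGalois K (E j)) ∧ (∀ j, Module.finrank K (E j) = p) ∧
        (∀ j r, j ≠ r → IsEmpty (E j ≃ₐ[K] E r)) ∧
        (∀ j, rk (E j) (hE j) (πE j) < rk K hK π) ∧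
        (∀ (j : J) (w : HeightOneSpectrum (𝓞 (E j))) (u : HeightOneSpectrum (𝓞 K))
            (α : Multiset ℂ), w.asIdeal.under (𝓞 K) = u.asIdeal → π.1.HasSatakeParamAt u α →
          (πE j).1.HasSatakeParamAt w (α.map (· ^ w.asIdeal.inertiaDeg (𝓞 K)))) ∧
        (∀ j : J, ∃ w : HeightOneSpectrum (𝓞 (E j)), w.asIdeal.under (𝓞 K) = (v j).asIdeal ∧
          w.asIdeal.inertiaDeg (𝓞 K) = 1 ∧ w.asIdeal.ramificationIdx (𝓞 K) = 1)

/-- **Kim 2003, Prop. 4.2.4–4.2.5 (Ramakrishnan's descent criterion, [Ra1, §3.6], and its isobaric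
extension, Appendix 1, with Remark 4.2), on Satake parameters.** For a countable infinite family of
pairwise non-isomorphic Galois extensions `K_j/F` of prime degree `p` and automorphic `Q_j` on
`GL_n(𝔸_{K_j})` "induced from cuspidal representations" (an a.e. description `t_{Q_j} = ⊎ᵢ t_{σᵢ}` by
cuspidal data) satisfying the descent condition **(DC)** — for all `j, r`, the base changes of `Q_j`
and `Q_r` to any common overfield `L` have the same Satake parameters almost everywhere,
`t_{Q_j,w∩K_j}^{f(w|w∩K_j)} = t_{Q_r,w∩K_r}^{f(w|w∩K_r)}` — there is an automorphic `P` on `GL_n(𝔸_F)`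
with `P_{K_j} ≃ Q_j` for all but finitely many `j`, rendered by its consequence at split places: for
almost all `j`, `t_{P,v} = t_{Q_j,w}` whenever `w ∣ v` has `e(w|v) = f(w|v) = 1` (Arthur–Clozel,
Ch. 3, (1.1) and Thm. 5.1: base change is the identity at a split place). Verbatim the hypothesis
`hDescent` of `Kim2003_exteriorSquare_GL4.of_leaves` / `.of_leaves'`; the same statement serves
Ramakrishnan's own Theorem M (`RamakrishnanBoxTimesDescent`).
[cite: Kim2002, Prop. 4.2.4, Prop. 4.2.5, Remark 4.2 (p. 157) and Appendix 1] [cite: Ramakrishnan2000, §3.6 (Prop. 3.6.1)]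
[cite: ArthurClozelAMS120, Ch. 3 (1.1) and Thm. 5.1] -/
def Kim2003_descentCriterion_isobaric : Prop :=
  ∀ (F : Type) [Field F] [NumberField F]
    (hF : ∀ m : ℕ, isCompact_glFiniteIntegralLevel m F) (n p : ℕ), p.Prime →
    ∀ (ι : Type) [Countable ι] [Infinite ι] (K : ι → Type) [∀ j, Field (K j)]
      [∀ j, NumberField (K j)] [∀ j, Algebra F (K j)],
      (∀ j, IsGalois F (K j)) → (∀ j, Module.finrank F (K j) = p) →
      (∀ j r, j ≠ r → IsEmpty (K j ≃ₐ[F] K r)) →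
    ∀ (hK : ∀ (j : ι) (m : ℕ), isCompact_glFiniteIntegralLevel m (K j))
      (Q : ∀ j, AutomorphicRepData (AutomorphyDatum.gl n (K j) (hK j n))),
      (∀ j, ∃ (k : ℕ) (m : Fin k → ℕ)
          (σ : ∀ i : Fin k, CuspidalAutomorphicRepData (m i) (K j) (hK j (m i))),
        (∑ i, m i = n) ∧ ∀ᶠ w : HeightOneSpectrum (𝓞 (K j)) in cofinite, ∀ β : Fin k → Multiset ℂ,
          (∀ i, (σ i).1.HasSatakeParamAt w (β i)) → (Q j).HasSatakeParamAt w (∑ i, β i)) →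
      (∀ (j r : ι) (L : Type) [Field L] [NumberField L] [Algebra F L] [Algebra (K j) L]
          [Algebra (K r) L] [IsScalarTower F (K j) L] [IsScalarTower F (K r) L],
        ∀ᶠ w : HeightOneSpectrum (𝓞 L) in cofinite, ∀ β γ : Multiset ℂ,
          (Q j).HasSatakeParamAt (w.under (𝓞 (K j))) β →
            (Q r).HasSatakeParamAt (w.under (𝓞 (K r))) γ →
              β.map (· ^ w.asIdeal.inertiaDeg (𝓞 (K j))) =
                γ.map (· ^ w.asIdeal.inertiaDeg (𝓞 (K r)))) →
      ∃ P : AutomorphicRepData (AutomorphyDatum.gl n F (hF n)),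
        ∀ᶠ j : ι in cofinite, ∀ (w : HeightOneSpectrum (𝓞 (K j))) (v : HeightOneSpectrum (𝓞 F)),
          w.asIdeal.under (𝓞 F) = v.asIdeal → w.asIdeal.inertiaDeg (𝓞 F) = 1 →
            w.asIdeal.ramificationIdx (𝓞 F) = 1 →
              ∀ β : Multiset ℂ, (Q j).HasSatakeParamAt w β → P.HasSatakeParamAt v β

/-- **Cuspidal support on Satake parameters (Langlands 1979, Prop. 2; Kim 2003, (4.1), p. 154, after
[J-S3]): every automorphic representation of `GL_n(𝔸_F)` is nearly equivalent to an isobaric sum of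
cuspidal data.** For every automorphic `P` on `GL_n(𝔸_F)` (Borel–Jacquet datum) there are `k`,
degrees `nᵢ` with `∑ nᵢ = n` and cuspidal `σᵢ` on `GL_{nᵢ}(𝔸_F)` such that for almost all finite `v`,
whenever the `σᵢ` have Satake parameters `βᵢ` at `v`, `P` has Satake parameter `⊎ᵢ βᵢ` at `v` (Kim:
"By the classification of automorphic representations of `GL_n` [J-S3], `Π` is equivalent to a
subquotient of `Ind |det|^{r₁}τ₁ ⊗ ⋯ ⊗ |det|^{r_k}τ_k` … the Hecke conjugacy class of `Π_v` is the
same as that of `Ξ_v`"; the twists `|det|^{rᵢ} τᵢ` are again cuspidal data in the tree's sense).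
Verbatim the hypothesis `hSupp` of `Kim2003_exteriorSquare_GL4.of_leaves'`, i.e. the isobaric clause
(ii) of `Kim2003_exteriorSquare_GL4` read backwards.
[cite: LanglandsCorvallis1979Notion, Prop. 2] [cite: Kim2002, (4.1) (p. 154)] -/
def Langlands1979_cuspidalSupport_satakeParams : Prop :=
  ∀ (F : Type) [Field F] [NumberField F]
    (hF : ∀ m : ℕ, isCompact_glFiniteIntegralLevel m F) (n : ℕ)
    (P : AutomorphicRepData (AutomorphyDatum.gl n F (hF n))),
    ∃ (k : ℕ) (m : Fin k → ℕ) (σ : ∀ i : Fin k, CuspidalAutomorphicRepData (m i) F (hF (m i))),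
      (∑ i, m i = n) ∧ ∀ᶠ v : HeightOneSpectrum (𝓞 F) in cofinite, ∀ β : Fin k → Multiset ℂ,
        (∀ i, (σ i).1.HasSatakeParamAt v (β i)) → P.HasSatakeParamAt v (∑ i, β i)

/-! ### The assembly -/

/-- **Kim 2003, Theorem A / Thm. 4.2.3 (`Kim2003_exteriorSquare_GL4`) from its four named leaves**
(fact-decomposition glue, canonical name): the good case (Thm. 4.1.1), the family of the induction
step (pp. 156–157), the descent criterion (Prop. 4.2.4–4.2.5) and cuspidal support ((4.1)); the
induction of §4.2 itself is the PROVED theorem `Kim2003_exteriorSquare_GL4.of_leaves'`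
(`KimExteriorSquareGL4Descent`). [cite: Kim2002, Thm. 4.2.3 (p. 156) with §4.1 (p. 153) and §4.2 (pp. 156–158)] -/
theorem Kim2003_exteriorSquare_GL4_holds_of
    (hGood : Kim2003_exteriorSquare_goodCase)
    (hStep : Kim2003_exteriorSquare_inductionStepFamily)
    (hDescent : Kim2003_descentCriterion_isobaric)
    (hSupp : Langlands1979_cuspidalSupport_satakeParams) : Kim2003_exteriorSquare_GL4 :=
  Kim2003_exteriorSquare_GL4.of_leaves' (hDescent := hDescent) (hSupp := hSupp) hGood hStep

end Literature.NumberTheory.Automorphic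

end
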